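import Summits.Parity.GeneralizedHardyLittlewood.Theorems.PrimeLevelFamEdgeIdeaDeltasNewFamiliesDefs
import Summits.Parity.GeneralizedHardyLittlewood.Theorems.PrimeLevelFamEdgeIdeaDeltasSplitPrimesCover

/-!
# Route `PrimeLevelFamEdge` — TYPED IDEA DELTAS, deck 9b: the SPLIT-PRIME shapes of annex A-I8-5
# DISCHARGED BY CITE (cell ls-idea, lens-8 sixth wave offers (6.6)(b)/(c); KERNEL glue)

Deck 3 §2‴ (`PrimeLevelFamEdgeIdeaDeltasNewFamiliesDefs.lean`, p579100) typed the two consumer shapes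
of annex A-I8-5 «second dial + harmonic confinement» as PARAMETRIC hypotheses, NOT asserted:
`SplitHarmonicMassConfined t C K` ((R1): in the (A)_{3/2}-world `L(1,χ)(log D)^{3/2} ≤ 1`, the harmonic
mass of split primes in `[D^t, D^C]` is `≤ K (log D)^{−t/(1+4t)}`) and `SplitLogMassSmall ε D₀`
(consequence (i): `Σ_{split p ≤ D} log p/p ≤ ε log D` beyond `D₀`). Lens-8's sixth wave (6.1) LOCATED
both in print — Tao–Teräväinen 2022 Prop. 3.5 (3.22)–(3.23) and Heath-Brown 1983 Lemma 3 (= TT (3.20))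
— and offered (6.6)(b)/(c): discharge the shapes BY CITE. This file does exactly that, as theorems
CONDITIONAL on the two Literature NAMED FACTS (`taoTeravainen2022_proposition35`, p583005;
`heathBrown1983_lemma3`, p592346) and otherwise kernel-checked:

* `splitHarmonicMassConfined_of_taoTeravainen : taoTeravainen2022_proposition35 →
    ∀ t C, 0 < t → t < C → ∃ K, SplitHarmonicMassConfined t C K` — the annex's claim in its original
  `∀ t C ∃ K` form. (The UNIFORM form «`∃ K₀ ∀ t C, … K₀(C + 1/t)`» suggested in (6.6)(b) does NOT
  follow from Prop. 3.5 with one fixed `ε`: reaching `D^t` needs `M ≈ (1+ε)/(2t)` bands whose decay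
  `η^{−1/M} ≈ (log D)^{−t/(1+ε)}` is weaker than the shape's `(log D)^{−t/(1+4t)}` once `t < ε/4`; with
  `ε = ε(t) ≤ 2t` the printed constant `C(ε)` depends on `t`. Recorded, not contested further.)
* `splitLogMassSmall_of_heathBrown : heathBrown1983_lemma3 → ∀ ε > 0, ∃ D₀, SplitLogMassSmall ε D₀`.

Chain (both): (A)_{3/2} and `χ` real `≠ 1` ⇒ `‖L(1,χ)‖ = Re L(1,χ) ≤ (log D)^{−3/2}` ⇒ (tree, PROVED
from Hecke: `exists_quality_of_norm_lOne_le`, p592218) a Siegel zero `β = 1 − 1/(η log D)` of quality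
`η ≥ c₀ (log D)^{1/2}` (`≥ 10` for `log D` large) ⇒ the printed bounds in `η`-currency ⇒ the shapes,
with the small moduli absorbed into the constants by trivial bounds (covering lemmas: deck 9a
`PrimeLevelFamEdgeIdeaDeltasSplitPrimesCover.lean`). NOTHING here proves the named
facts, and nothing asserts that an exceptional character exists: «no exceptional-zero theorem (no
Landau–Siegel / Siegel-zero exclusion, no Theorem 1–2 of arXiv:2211.02515, no repaired Margin232) is
proved by ideation; typed ≠ proved; a discharge modulo a NAMED FACT is conditional on that fact».
-/

noncomputable section

namespace Summit.Parity.GeneralizedHardyLittlewood.Theorems.PrimeLevelFamEdgeIdeaDeltas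

open Literature.NumberTheory.LFunctions

/-! ### (6.6)(b): (R1) from Tao–Teräväinen Prop. 3.5 -/

/-- **(R1) DISCHARGED BY CITE (annex A-I8-5, lens-8 (6.6)(b)):** modulo the named fact
`taoTeravainen2022_proposition35` (TT22 Prop. 3.5 (3.22)–(3.23)), for all exponents `0 < t < C` there is
a constant `K = K(t, C)` with `SplitHarmonicMassConfined t C K`: in the (A)_{3/2}-world the harmonic
mass of the split primes in `[D^t, D^C]` is `≤ K (log D)^{−t/(1+4t)}`. Proof: quality `η ≥ c₀√(log D)`
(Hecke, tree); cover `[D^t, D^{(1+t)/2}]` by the bands `m = 2, …, M`, `M = ⌊(1+t)/(2t)⌋ + 1`, of (3.23)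
with `ε = t` (decay `η^{−1/m} ≤ η^{−1/M} ≤ c₀^{−1/M}(log D)^{−1/(2M)}`, and `1/(2M) ≥ t/(1+4t)`), and
`(D^{(1+t)/2}, D^{max(C,(1+t)/2)}]` by (3.22) (`≪ 1/η ≤ (log D)^{−1/2}/c₀`); small `log D` by the trivial
bound `Σ ≤ D^C`. CONDITIONAL on the named fact; nothing asserts that an exceptional character exists.
[cite: TaoTeravainen2022SiegelZero, Proposition 3.5 (3.22)–(3.23)] [cite: MontgomeryVaughan2007, Thm. 11.4] -/
theorem splitHarmonicMassConfined_of_taoTeravainen (hTT : taoTeravainen2022_proposition35)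
    {t C : ℝ} (ht : 0 < t) (htC : t < C) : ∃ K : ℝ, SplitHarmonicMassConfined t C K := by
  obtain ⟨Cε, hCε⟩ := hTT t ht
  obtain ⟨c₀, hc₀, T, hT2, hQ⟩ := exists_quality_of_threeHalves
  have hCpos : 0 < C := ht.trans htC
  have hTpos : 0 < T := by linarith
  -- the band count and the target exponent
  obtain ⟨M, hMdef⟩ : ∃ M : ℕ, M = ⌊(1 + t) / (2 * t)⌋₊ + 1 := ⟨_, rfl⟩
  obtain ⟨a, hadef⟩ : ∃ a : ℝ, a = t / (1 + 4 * t) := ⟨_, rfl⟩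
  have ha0 : 0 < a := by rw [hadef]; positivity
  have ha_half : a ≤ 1 / 2 := by
    rw [hadef, div_le_div_iff₀ (by positivity) (by norm_num)]; linarith
  have hM1 : (1 : ℝ) ≤ M := by
    have : 1 ≤ M := by rw [hMdef]; exact Nat.le_add_left 1 _
    exact_mod_cast this
  have hMpos : (0 : ℝ) < M := by linarith
  have hMle : (M : ℝ) ≤ (1 + t) / (2 * t) + 1 := by
    rw [hMdef, Nat.cast_add, Nat.cast_one]
    have := Nat.floor_le (show (0 : ℝ) ≤ (1 + t) / (2 * t) by positivity)
    linarith
  have ha_M : a ≤ 1 / (2 * M) := by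
    rw [hadef, div_le_div_iff₀ (by positivity) (by positivity)]
    have h1 : ((1 + t) / (2 * t) + 1) * (2 * t) = 1 + 3 * t := by
      field_simp
      ring
    have h2 : (M : ℝ) * (2 * t) ≤ 1 + 3 * t := by
      rw [← h1]; exact mul_le_mul_of_nonneg_right hMle (by positivity)
    nlinarith
  obtain ⟨C', hC'def⟩ : ∃ C' : ℝ, C' = max C ((1 + t) / 2) := ⟨_, rfl⟩
  have hCC' : C ≤ C' := by rw [hC'def]; exact le_max_left _ _
  have htC' : (1 + t) / 2 ≤ C' := by rw [hC'def]; exact le_max_right _ _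
  have hC'pos : 0 < C' := lt_of_lt_of_le hCpos hCC'
  obtain ⟨Cp, hCpdef⟩ : ∃ Cp : ℝ, Cp = max Cε 0 := ⟨_, rfl⟩
  have hCp0 : 0 ≤ Cp := by rw [hCpdef]; exact le_max_right _ _
  have hCεle : Cε ≤ Cp := by rw [hCpdef]; exact le_max_left _ _
  -- constants
  obtain ⟨K₁, hK₁def⟩ : ∃ K₁ : ℝ, K₁ = Real.exp (C * T) * T ^ a := ⟨_, rfl⟩
  obtain ⟨K₂, hK₂def⟩ : ∃ K₂ : ℝ, K₂ = Cp * ((M : ℝ) ^ 2 * c₀ ^ (-(1 / (M : ℝ))) + C' / c₀) :=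
    ⟨_, rfl⟩
  have hK₁0 : 0 ≤ K₁ := by rw [hK₁def]; positivity
  have hc₀M : 0 < c₀ ^ (-(1 / (M : ℝ))) := Real.rpow_pos_of_pos hc₀ _
  have hK₂0 : 0 ≤ K₂ := by
    rw [hK₂def]
    have : 0 ≤ (M : ℝ) ^ 2 * c₀ ^ (-(1 / (M : ℝ))) + C' / c₀ :=
      add_nonneg (mul_nonneg (sq_nonneg _) hc₀M.le) (div_nonneg hC'pos.le hc₀.le)
    exact mul_nonneg hCp0 this
  refine ⟨max K₁ K₂, ?_⟩
  intro D _ χ hχ hprim hquad hA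
  have hD0 : (0 : ℝ) < D := by exact_mod_cast Nat.pos_of_ne_zero (NeZero.ne D)
  obtain ⟨ℓ, hℓdef⟩ : ∃ ℓ : ℝ, ℓ = Real.log (D : ℝ) := ⟨_, rfl⟩
  rw [← hℓdef] at hA ⊢
  rw [← hadef]
  have hℓ0 : 0 ≤ ℓ := by rw [hℓdef]; exact Real.log_natCast_nonneg D
  have hRHS0 : 0 ≤ max K₁ K₂ * ℓ ^ (-a) :=
    mul_nonneg (le_max_of_le_left hK₁0) (Real.rpow_nonneg hℓ0 _)
  -- D = 1: no primes in the range
  by_cases hD1 : D = 1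
  · subst hD1
    have hF0 : (Finset.Icc ⌈((1 : ℕ) : ℝ) ^ t⌉₊ ⌊((1 : ℕ) : ℝ) ^ C⌋₊).filter
        (fun p : ℕ => p.Prime ∧ χ ((p : ℕ) : ZMod 1) = 1) = ∅ := by
      rw [Finset.filter_eq_empty_iff]
      intro p hp hP
      simp only [Nat.cast_one, Real.one_rpow, Nat.floor_one, Finset.mem_Icc] at hp
      exact absurd (le_antisymm hp.2 hP.1.one_lt.le) hP.1.one_lt.ne'
    rw [hF0, Finset.sum_empty]
    exact hRHS0
  have hD2 : 2 ≤ D := by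
    rcases Nat.eq_zero_or_pos D with h0 | hpos
    · exact absurd h0 (NeZero.ne D)
    · omega
  have hD1r : (1 : ℝ) < D := by exact_mod_cast hD2
  have hℓpos : 0 < ℓ := by rw [hℓdef]; exact Real.log_pos hD1r
  by_cases hsmall : ℓ < T
  · -- small D: Σ ≤ D^C = exp(C ℓ) ≤ exp(C T) = K₁ T^{-a} ≤ K₁ ℓ^{-a}
    have h0 := splitSum_le_rpow χ t C
    have h1 : (D : ℝ) ^ C ≤ Real.exp (C * T) := by
      rw [Real.rpow_def_of_pos hD0, Real.exp_le_exp, ← hℓdef]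
      nlinarith
    have h2 : Real.exp (C * T) = K₁ * T ^ (-a) := by
      rw [hK₁def, mul_assoc, ← Real.rpow_add hTpos]
      simp
    have h3 : K₁ * T ^ (-a) ≤ K₁ * ℓ ^ (-a) :=
      mul_le_mul_of_nonneg_left (Real.rpow_le_rpow_of_nonpos hℓpos hsmall.le (by linarith)) hK₁0
    have h4 : K₁ * ℓ ^ (-a) ≤ max K₁ K₂ * ℓ ^ (-a) :=
      mul_le_mul_of_nonneg_right (le_max_left _ _) (Real.rpow_nonneg hℓpos.le _)
    linarith
  -- large D
  push Not at hsmall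
  have hℓ1 : 1 ≤ ℓ := by linarith
  have hTℓ : T ≤ Real.log D := by rw [← hℓdef]; exact hsmall
  have hA' : (χ.LFunction 1).re * Real.log (D : ℝ) ^ (3 / 2 : ℝ) ≤ 1 := by rw [← hℓdef]; exact hA
  obtain ⟨η, hη10, hηge, hzero⟩ := hQ D χ hχ hquad hTℓ hA'
  rw [← hℓdef] at hηge
  have hη1 : 1 ≤ η := by linarith
  have hηpos : 0 < η := by linarith
  have hsqrtℓ : 0 < Real.sqrt ℓ := Real.sqrt_pos.mpr hℓpos
  have hη₀pos : 0 < c₀ * Real.sqrt ℓ := mul_pos hc₀ hsqrtℓ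
  obtain ⟨h22, h23⟩ := hCε D χ hχ hprim hquad η hη10 hzero
  -- the two printed bounds, in the form the covering lemma wants
  have hxge : (D : ℝ) ^ ((1 + t) / 2) ≤ (D : ℝ) ^ C' :=
    Real.rpow_le_rpow_of_exponent_le hD1r.le htC'
  have htail : exceptionalPrimeHarmonicSum χ ((D : ℝ) ^ ((1 + t) / 2)) ((D : ℝ) ^ C') ≤
      Cp * C' / η := by
    have hlogx : Real.log ((D : ℝ) ^ C') / Real.log D = C' := by
      rw [Real.log_rpow hD0, ← hℓdef, mul_div_assoc, div_self hℓpos.ne', mul_one]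
    calc exceptionalPrimeHarmonicSum χ ((D : ℝ) ^ ((1 + t) / 2)) ((D : ℝ) ^ C')
        ≤ Cε * (Real.log ((D : ℝ) ^ C') / Real.log D) / η := h22 _ hxge
      _ = Cε * C' / η := by rw [hlogx]
      _ ≤ Cp * C' / η := by
          apply div_le_div_of_nonneg_right _ hηpos.le
          exact mul_le_mul_of_nonneg_right hCεle hC'pos.le
  have hX₂pos : 0 < Cp * M / (c₀ * Real.sqrt ℓ) ^ (1 / (M : ℝ)) + 1 := by
    have : 0 ≤ Cp * M / (c₀ * Real.sqrt ℓ) ^ (1 / (M : ℝ)) :=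
      div_nonneg (mul_nonneg hCp0 hMpos.le) (Real.rpow_nonneg hη₀pos.le _)
    linarith
  have hband : ∀ m : ℕ, 2 ≤ m → m ≤ ⌊(1 + t) / (2 * t)⌋₊ + 1 →
      exceptionalPrimeHarmonicSum χ ((D : ℝ) ^ ((1 + t) / (2 * m)))
        ((D : ℝ) ^ ((1 + t) / (2 * (m - 1 : ℝ)))) ≤ Cp * M / (c₀ * Real.sqrt ℓ) ^ (1 / (M : ℝ)) := by
    intro m hm2 hmM
    rw [← hMdef] at hmM
    have hmpos : (0 : ℝ) < m := by
      have : (2 : ℝ) ≤ m := by exact_mod_cast hm2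
      linarith
    have hmM' : (1 : ℝ) / M ≤ 1 / m := one_div_le_one_div_of_le hmpos (by exact_mod_cast hmM)
    have hle1 : (c₀ * Real.sqrt ℓ) ^ (1 / (M : ℝ)) ≤ η ^ (1 / (M : ℝ)) :=
      Real.rpow_le_rpow hη₀pos.le hηge (by positivity)
    have hle2 : η ^ (1 / (M : ℝ)) ≤ η ^ (1 / (m : ℝ)) :=
      Real.rpow_le_rpow_of_exponent_le hη1 hmM'
    have hden : 0 < (c₀ * Real.sqrt ℓ) ^ (1 / (M : ℝ)) := Real.rpow_pos_of_pos hη₀pos _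
    calc exceptionalPrimeHarmonicSum χ ((D : ℝ) ^ ((1 + t) / (2 * m)))
          ((D : ℝ) ^ ((1 + t) / (2 * (m - 1 : ℝ))))
        ≤ Cε * m / η ^ (1 / (m : ℝ)) := h23 m hm2
      _ ≤ Cp * M / η ^ (1 / (m : ℝ)) := by
          apply div_le_div_of_nonneg_right _ (Real.rpow_nonneg hηpos.le _)
          have : (m : ℝ) ≤ M := by exact_mod_cast hmM
          calc Cε * m ≤ Cp * m := mul_le_mul_of_nonneg_right hCεle hmpos.le
            _ ≤ Cp * M := mul_le_mul_of_nonneg_left this hCp0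
      _ ≤ Cp * M / (c₀ * Real.sqrt ℓ) ^ (1 / (M : ℝ)) :=
          div_le_div_of_nonneg_left (mul_nonneg hCp0 hMpos.le) hden (hle1.trans hle2)
  have hcover := splitSum_le_of_bands hD2 χ ht hCC'
    (div_nonneg (mul_nonneg hCp0 hMpos.le) (Real.rpow_nonneg hη₀pos.le _)) htail hband
  rw [← hMdef] at hcover
  -- convert to powers of ℓ
  have hsqrt_rpow : Real.sqrt ℓ = ℓ ^ (1 / 2 : ℝ) := Real.sqrt_eq_rpow ℓ
  have hband_pow : (M : ℝ) * (Cp * M / (c₀ * Real.sqrt ℓ) ^ (1 / (M : ℝ))) ≤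
      Cp * ((M : ℝ) ^ 2 * c₀ ^ (-(1 / (M : ℝ)))) * ℓ ^ (-a) := by
    have hsplit : (c₀ * Real.sqrt ℓ) ^ (1 / (M : ℝ)) =
        c₀ ^ (1 / (M : ℝ)) * ℓ ^ (1 / (2 * M) : ℝ) := by
      rw [Real.mul_rpow hc₀.le hsqrtℓ.le, hsqrt_rpow, ← Real.rpow_mul hℓpos.le]
      congr 1
      ring
    have hℓa : ℓ ^ a ≤ ℓ ^ (1 / (2 * M) : ℝ) := Real.rpow_le_rpow_of_exponent_le hℓ1 ha_M
    have hℓapos : 0 < ℓ ^ a := Real.rpow_pos_of_pos hℓpos _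
    have hc₀M' : 0 < c₀ ^ (1 / (M : ℝ)) := Real.rpow_pos_of_pos hc₀ _
    have hX : c₀ ^ (1 / (M : ℝ)) * ℓ ^ a ≤ (c₀ * Real.sqrt ℓ) ^ (1 / (M : ℝ)) := by
      rw [hsplit]; exact mul_le_mul_of_nonneg_left hℓa hc₀M'.le
    have hstep : Cp * M / (c₀ * Real.sqrt ℓ) ^ (1 / (M : ℝ)) ≤ Cp * M / (c₀ ^ (1 / (M : ℝ)) * ℓ ^ a) :=
      div_le_div_of_nonneg_left (mul_nonneg hCp0 hMpos.le) (mul_pos hc₀M' hℓapos) hX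
    have heq : (M : ℝ) * (Cp * M / (c₀ ^ (1 / (M : ℝ)) * ℓ ^ a)) =
        Cp * ((M : ℝ) ^ 2 * c₀ ^ (-(1 / (M : ℝ)))) * ℓ ^ (-a) := by
      rw [Real.rpow_neg hc₀.le, Real.rpow_neg hℓpos.le]
      field_simp
    calc (M : ℝ) * (Cp * M / (c₀ * Real.sqrt ℓ) ^ (1 / (M : ℝ)))
        ≤ (M : ℝ) * (Cp * M / (c₀ ^ (1 / (M : ℝ)) * ℓ ^ a)) :=
          mul_le_mul_of_nonneg_left hstep hMpos.le
      _ = Cp * ((M : ℝ) ^ 2 * c₀ ^ (-(1 / (M : ℝ)))) * ℓ ^ (-a) := heq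
  have htail_pow : Cp * C' / η ≤ Cp * (C' / c₀) * ℓ ^ (-a) := by
    have h1 : Cp * C' / η ≤ Cp * C' / (c₀ * Real.sqrt ℓ) :=
      div_le_div_of_nonneg_left (mul_nonneg hCp0 hC'pos.le) hη₀pos hηge
    have hℓa : ℓ ^ a ≤ Real.sqrt ℓ := by
      rw [hsqrt_rpow]; exact Real.rpow_le_rpow_of_exponent_le hℓ1 ha_half
    have hℓapos : 0 < ℓ ^ a := Real.rpow_pos_of_pos hℓpos _
    have h2 : Cp * C' / (c₀ * Real.sqrt ℓ) ≤ Cp * C' / (c₀ * ℓ ^ a) :=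
      div_le_div_of_nonneg_left (mul_nonneg hCp0 hC'pos.le) (mul_pos hc₀ hℓapos)
        (mul_le_mul_of_nonneg_left hℓa hc₀.le)
    have h3 : Cp * C' / (c₀ * ℓ ^ a) = Cp * (C' / c₀) * ℓ ^ (-a) := by
      rw [Real.rpow_neg hℓpos.le]
      field_simp
    linarith
  have hK₂ : Cp * (C' / c₀) * ℓ ^ (-a) + Cp * ((M : ℝ) ^ 2 * c₀ ^ (-(1 / (M : ℝ)))) * ℓ ^ (-a) =
      K₂ * ℓ ^ (-a) := by rw [hK₂def]; ring
  have hfin : K₂ * ℓ ^ (-a) ≤ max K₁ K₂ * ℓ ^ (-a) :=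
    mul_le_mul_of_nonneg_right (le_max_right _ _) (Real.rpow_nonneg hℓpos.le _)
  linarith [hcover, hband_pow, htail_pow]

/-! ### (6.6)(c): consequence (i) from Heath-Brown 1983, Lemma 3 (= TT (3.20)) -/

set_option exponentiation.threshold 1024 in
/-- **Consequence (i) DISCHARGED BY CITE (annex A-I8-5, lens-8 (6.6)(c)):** modulo the named fact
`heathBrown1983_lemma3` (HB83 Lemma 3 as quoted by TT22 (3.20): under a Siegel zero of quality
`η ≥ 10`, `Σ_{p ≤ q^500, χ(p)=1} log p/p ≤ C log q/√(log η)`), for every `ε > 0` there is `D₀` with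
`SplitLogMassSmall ε D₀`: in the (A)_{3/2}-world, `Σ_{p ≤ D, χ(p)=1} log p/p ≤ ε log D` for `D ≥ D₀`.
Proof: quality `η ≥ c₀√(log D)` (Hecke, tree) `≥ exp((C/ε)²)` once `log D ≥ (exp((C/ε)²)/c₀)²`, so
`C/√(log η) ≤ ε`; and `Σ_{p ≤ D} ≤ Σ_{p ≤ D^500}`. In the (A)_A-world this is the card's
`D₀(ε, A) = exp exp(O(1/(ε²(A−1))))` at `A = 3/2`. CONDITIONAL on the named fact; nothing asserts that an
exceptional character exists. [cite: HeathBrown1983PrimeTwins, Lemma 3 (as quoted in TaoTeravainen2022SiegelZero (3.20))] [cite: MontgomeryVaughan2007, Thm. 11.4] -/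
theorem splitLogMassSmall_of_heathBrown (hHB : heathBrown1983_lemma3) {ε : ℝ} (hε : 0 < ε) :
    ∃ D₀ : ℕ, SplitLogMassSmall ε D₀ := by
  obtain ⟨C, hC⟩ := hHB
  obtain ⟨c₀, hc₀, T, hT2, hQ⟩ := exists_quality_of_threeHalves
  obtain ⟨Cp, hCpdef⟩ : ∃ Cp : ℝ, Cp = max C 0 := ⟨_, rfl⟩
  have hCp0 : 0 ≤ Cp := by rw [hCpdef]; exact le_max_right _ _
  have hCle : C ≤ Cp := by rw [hCpdef]; exact le_max_left _ _
  obtain ⟨E, hEdef⟩ : ∃ E : ℝ, E = Real.exp ((Cp / ε) ^ 2) := ⟨_, rfl⟩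
  have hEpos : 0 < E := by rw [hEdef]; exact Real.exp_pos _
  obtain ⟨T₁, hT₁def⟩ : ∃ T₁ : ℝ, T₁ = max T ((E / c₀) ^ 2) := ⟨_, rfl⟩
  have hTT₁ : T ≤ T₁ := by rw [hT₁def]; exact le_max_left _ _
  have hET₁ : (E / c₀) ^ 2 ≤ T₁ := by rw [hT₁def]; exact le_max_right _ _
  refine ⟨⌈Real.exp T₁⌉₊, ?_⟩
  intro D _ χ hD₀ hχ hprim hquad hA
  have hDge : Real.exp T₁ ≤ (D : ℝ) := Nat.ceil_le.mp hD₀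
  have hD0 : (0 : ℝ) < D := lt_of_lt_of_le (Real.exp_pos _) hDge
  obtain ⟨ℓ, hℓdef⟩ : ∃ ℓ : ℝ, ℓ = Real.log (D : ℝ) := ⟨_, rfl⟩
  have hℓT₁ : T₁ ≤ ℓ := by
    rw [hℓdef, Real.le_log_iff_exp_le hD0]; exact hDge
  have hℓT : T ≤ Real.log (D : ℝ) := by rw [← hℓdef]; exact hTT₁.trans hℓT₁
  have hℓpos : 0 < ℓ := by linarith
  obtain ⟨η, hη10, hηge, hzero⟩ := hQ D χ hχ hquad hℓT hA
  rw [← hℓdef] at hηge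
  have hlogη : 0 < Real.log η := Real.log_pos (by linarith)
  have hsq : 0 < Real.sqrt (Real.log η) := Real.sqrt_pos.mpr hlogη
  -- the printed bound at range D^500 ⊇ [1, D]
  have hHB := hC D χ hχ hprim hquad η hη10 hzero
  rw [← hℓdef] at hHB
  have hmono : exceptionalPrimeLogSum χ D ≤ exceptionalPrimeLogSum χ (D ^ 500) :=
    exceptionalPrimeLogSum_mono χ (Nat.le_self_pow (by norm_num) D)
  -- η ≥ c₀ √ℓ ≥ E = exp((Cp/ε)²)  ⇒  √(log η) ≥ Cp/ε
  have hηE : E ≤ η := by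
    have h1 : Real.sqrt ((E / c₀) ^ 2) ≤ Real.sqrt ℓ := Real.sqrt_le_sqrt (hET₁.trans hℓT₁)
    rw [Real.sqrt_sq (by positivity)] at h1
    have h2 : c₀ * (E / c₀) ≤ c₀ * Real.sqrt ℓ := mul_le_mul_of_nonneg_left h1 hc₀.le
    rw [mul_div_cancel₀ _ hc₀.ne'] at h2
    exact h2.trans hηge
  have hsqrtge : Cp / ε ≤ Real.sqrt (Real.log η) := by
    have h1 : (Cp / ε) ^ 2 ≤ Real.log η := by
      rw [← Real.log_exp ((Cp / ε) ^ 2), ← hEdef]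
      exact Real.log_le_log hEpos hηE
    have h2 := Real.sqrt_le_sqrt h1
    rwa [Real.sqrt_sq (by positivity)] at h2
  have hfinal : Cp * ℓ / Real.sqrt (Real.log η) ≤ ε * ℓ := by
    rw [div_le_iff₀ hsq]
    have : Cp ≤ ε * Real.sqrt (Real.log η) := by
      rw [div_le_iff₀ hε] at hsqrtge; linarith
    nlinarith
  have key : exceptionalPrimeLogSum χ D ≤ ε * ℓ := by
    calc exceptionalPrimeLogSum χ D ≤ exceptionalPrimeLogSum χ (D ^ 500) := hmono
      _ ≤ C * ℓ / Real.sqrt (Real.log η) := hHB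
      _ ≤ Cp * ℓ / Real.sqrt (Real.log η) :=
          div_le_div_of_nonneg_right (mul_le_mul_of_nonneg_right hCle hℓpos.le) hsq.le
      _ ≤ ε * ℓ := hfinal
  rw [← hℓdef]
  exact key

end Summit.Parity.GeneralizedHardyLittlewood.Theorems.PrimeLevelFamEdgeIdeaDeltas
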